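import Literature.AlgebraicGeometry.Morphisms.SectionsProjectiveOfFibreVanishing
import HarnessLib

/-!
# The rank of `Γ(X, G)` is `h⁰` of the fibre, when `H¹` of the fibres vanishes (Mumford §5 Cor. 2 / Cor. 3, degree `0`)

[cite: MumfordAV1970, §5, Corollary 2 (p. 50) and Corollary 3 (p. 53)]
[cite: Hartshorne1977, III Theorem 12.11 (p. 290) and Corollary 12.9 (p. 288)]

Sequel to ★ `Morphisms/SectionsProjectiveOfFibreVanishing` (FILE A: `Γ(X, G)` is finitely generated projective from
`H¹`-vanishing of the fibres).  This file computes its RANK: at a prime `𝔭`, the rank of `Γ(X, G)` is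
`h⁰(X_𝔭, G|_{X_𝔭}) = dim Γ(X_𝔭, G|_{X_𝔭})` («cohomology and base change» in degree `0` at the point, ★
`exists_tensor_secMod_top_linearEquiv_closedFibre`, and freeness over the local ring).

* §1 `finrank_secMod_top_eq_of_subsingleton_ext` — LOCAL base: `rk Γ(X, G) = dim_{κ} Γ(X₀, G|_{X₀})` (`Γ(X, G)` is free over
  the local ring by FILE A, and `κ ⊗ Γ(X, G) ≃ Γ(X₀, G|_{X₀})`);
* §2 `finrank_tensor_secMod_top_atPrime` — over `Spec A` at a prime `𝔭`: `rk_{Γ(Spec A_𝔭)} (Γ(Spec A_𝔭) ⊗ Γ(X, G)) =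
  dim Γ(X_𝔭, G|_{X_𝔭})` (flat base change to `X ×_A A_𝔭` + §1 over the local base, closed fibre `X_𝔭`);
* §3 **`rankAtStalk_secMod_top_eq_of_forall_prime`** / **`…_of_forall_fiber`** — `f : X → Spec A` proper flat, `A` noetherian,
  `G` finite locally free, `Ext¹ = 0` and `h⁰ = r` on the fibre at every prime ⇒ `Module.rankAtStalk Γ(X, G) ≡ r` (Mathlib
  `Module.rankAtStalk_eq_finrank_tensorProduct` + the localization `Γ(Spec A_𝔭, 𝒪) = Γ(Spec A, 𝒪)_P` of FILE A).

Theorems only (one `private` algebra lemma); no instance, notation, named fact.  Universe `Scheme.{0}`.  Cell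
`hodgecm-mathlib`, F-DAG F-6 (VI) assembler FILE A2 (B-p04 (g20)); consumer `Modules/PushforwardHasRankOfFibreVanishing`
(`HasRank (π_*L) (m+1)`, MFK Prop. 7.3 step (VI)).  HC_CM is proved only modulo the 7 printed citations until rung 0 closes —
nothing here bears on a summit statement.

## References

* D. Mumford, *Abelian Varieties*, TIFR Studies in Mathematics 5 (1970), §5, Cor. 2 (p. 50), Cor. 3 (p. 53). [MumfordAV1970]
* R. Hartshorne, *Algebraic Geometry*, GTM 52 (1977), III Thm. 12.11 (p. 290), Cor. 12.9 (p. 288). [Hartshorne1977]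
* The Stacks Project, Tag 02KH (flat base change). [StacksProject]
-/

noncomputable section

set_option backward.isDefEq.respectTransparency false

open CategoryTheory CategoryTheory.Limits CategoryTheory.Abelian Opposite TopologicalSpace AlgebraicGeometry TensorProduct
open Literature.Algebra.Homology Literature.Algebra.Module

namespace Literature.AlgebraicGeometry.Morphisms

open Literature.AlgebraicGeometry.Modules Literature.AlgebraicGeometry.HodgeTheory Literature.AlgebraicGeometry.Motives

/-! ## §0 Two transport lemmas -/

section TransportLemmas

/-- **Global sections along an isomorphism of modules**: an isomorphism `Φ : M ≅ N` of `𝒪_Y`-modules induces an `R`-linear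
equivalence `Γ(Y, M) ≃ Γ(Y, N)`, `x ↦ Φ(x)`, of the modules of global sections (`R` acting through `ρ : R → Γ(Y, 𝒪)`; e.g. along
Mathlib's `pullbackComp`/`pullbackCongr`). [cite: Hartshorne1977, II §5 (p. 109)] -/
theorem exists_secMod_linearEquiv_of_iso {Y : Scheme.{0}} {R : Type} [CommRing R] (ρ : R →+* Γ(Y, ⊤))
    {M N : Y.Modules} (Φ : M ≅ N) :
    ∃ L : SecMod M ρ ⊤ ≃ₗ[R] SecMod N ρ ⊤,
      ∀ x, SecMod.val (L := N) (ρ := ρ) (L x) = Φ.hom.app ⊤ (SecMod.val (L := M) (ρ := ρ) x) := by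
  refine ⟨{ toFun := fun x => SecMod.mk (ρ := ρ) (Φ.hom.app ⊤ (SecMod.val (L := M) (ρ := ρ) x))
            invFun := fun y => SecMod.mk (ρ := ρ) (Φ.inv.app ⊤ (SecMod.val (L := N) (ρ := ρ) y))
            map_add' := fun x y => by
              apply SecMod.val_injective (L := N) (ρ := ρ)
              change Φ.hom.app ⊤ (SecMod.val (L := M) (ρ := ρ) x + SecMod.val (L := M) (ρ := ρ) y) = _
              rw [map_add]
              rfl
            map_smul' := fun c x => by
              apply SecMod.val_injective (L := N) (ρ := ρ)
              change Φ.hom.app ⊤ (toSections ρ ⊤ c • SecMod.val (L := M) (ρ := ρ) x) =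
                toSections ρ ⊤ c • Φ.hom.app ⊤ (SecMod.val (L := M) (ρ := ρ) x)
              rw [Scheme.Modules.Hom.app_smul]
            left_inv := fun x => by
              apply SecMod.val_injective (L := M) (ρ := ρ)
              change (Φ.hom ≫ Φ.inv).app ⊤ (SecMod.val (L := M) (ρ := ρ) x) = _
              rw [Φ.hom_inv_id]
              rfl
            right_inv := fun y => by
              apply SecMod.val_injective (L := N) (ρ := ρ)
              change (Φ.inv ≫ Φ.hom).app ⊤ (SecMod.val (L := N) (ρ := ρ) y) = _
              rw [Φ.inv_hom_id]
              rfl }, fun x => rfl⟩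

/-- The rank of a base change `S ⊗_R M` does not depend on the `R`-algebra `S` up to `R`-algebra isomorphism. [folklore] -/
private theorem finrank_baseChange_eq_of_algEquiv {R S₁ S₂ M : Type} [CommRing R] [CommRing S₁] [CommRing S₂]
    [Algebra R S₁] [Algebra R S₂] [AddCommGroup M] [Module R M] (e : S₁ ≃ₐ[R] S₂) :
    Module.finrank S₁ (S₁ ⊗[R] M) = Module.finrank S₂ (S₂ ⊗[R] M) := by
  let j : S₁ ⊗[R] M ≃ₗ[R] S₂ ⊗[R] M := TensorProduct.congr e.toLinearEquiv (LinearEquiv.refl R M)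
  have hc : ∀ (c : S₁) (x : S₁ ⊗[R] M), j (c • x) = e c • j x := by
    intro c x
    induction x using TensorProduct.induction_on with
    | zero => rw [smul_zero, map_zero, smul_zero]
    | tmul s m =>
      rw [TensorProduct.smul_tmul', TensorProduct.congr_tmul, TensorProduct.congr_tmul, TensorProduct.smul_tmul']
      change e (c * s) ⊗ₜ[R] m = (e c * e s) ⊗ₜ[R] m
      rw [map_mul]
    | add x y hx hy => rw [smul_add, map_add, hx, hy, map_add, smul_add]
  exact congrArg Cardinal.toNat (rank_eq_of_equiv_equiv e j.toAddEquiv e.bijective hc)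

end TransportLemmas

/-! ## §1 The local base: `rk Γ(X, G) = dim Γ(X₀, G|_{X₀})` -/

section Local

variable {X B : Scheme.{0}} (g : X ⟶ B) [IsAffine B] [IsProper g] [IsLocallyNoetherian B] [Flat g]
  [IsLocalRing Γ(B, ⊤)] (G : X.Modules) (hL : IsFiniteLocallyFree G)
  {X₀ B₀ : Scheme.{0}} {g₀ : X₀ ⟶ B₀} {k₀ : X₀ ⟶ X} {j₀ : B₀ ⟶ B} [IsAffine B₀] (H₀ : IsPullback k₀ g₀ g j₀)
  (e₀ : letI := (j₀.appLE ⊤ ⊤ le_top).hom.toAlgebra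
    IsLocalRing.ResidueField Γ(B, ⊤) ≃ₗ[Γ(B, ⊤)] Γ(B₀, ⊤))
  (hvan : Subsingleton (Ext.{1} (unitModule X₀) ((Scheme.Modules.pullback k₀).obj G) 1))

include H₀ e₀ hvan hL in
/-- **`rk Γ(X, G) = h⁰(X₀, G|_{X₀})` over a LOCAL base** (Mumford §5 Cor. 2–3 / Hartshorne III 12.11 with Cor. 12.9, degree `0`):
`g : X → B` proper flat, `B` affine with local noetherian ring, `G` finite locally free, `X₀` the closed fibre (a cartesian square
over `j₀` identified with the residue field by `e₀`) with `Ext¹(𝒪_{X₀}, G|_{X₀}) = 0`.  Then the free `Γ(B, 𝒪)`-module `Γ(X, G)`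
has rank `dim_{Γ(B₀, 𝒪)} Γ(X₀, G|_{X₀})`.
[cite: MumfordAV1970, §5 Cor. 2 (p. 50)] [cite: Hartshorne1977, III Thm. 12.11 (p. 290), Cor. 12.9] -/
theorem finrank_secMod_top_eq_of_subsingleton_ext :
    Module.finrank Γ(B, ⊤) (SecMod G g.appTop.hom ⊤) =
      Module.finrank Γ(B₀, ⊤) (SecMod ((Scheme.Modules.pullback k₀).obj G) g₀.appTop.hom ⊤) := by
  obtain ⟨hfin, hproj⟩ := finite_and_projective_secMod_top_of_subsingleton_ext g G hL H₀ e₀ hvan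
  haveI := hfin
  haveI := hproj
  haveI : Module.Free Γ(B, ⊤) (SecMod G g.appTop.hom ⊤) := Module.free_of_flat_of_isLocalRing
  letI := (j₀.appLE ⊤ ⊤ le_top).hom.toAlgebra
  haveI : Nontrivial Γ(B₀, ⊤) := e₀.toEquiv.symm.nontrivial
  obtain ⟨E, -⟩ := exists_tensor_secMod_top_linearEquiv_closedFibre g G hL H₀ e₀ hvan
  rw [← E.finrank_eq, Module.finrank_baseChange]

end Local

/-! ## §2 Over `Spec A`, at a prime `𝔭`: `rk (Γ(Spec A_𝔭) ⊗ Γ(X, G)) = h⁰(X_𝔭, G|_{X_𝔭})` -/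

section AtPrime

/-- **The local step at a prime `𝔭 ⊂ A`**: for `f : X → Spec A` proper flat (`A` noetherian), `G` finite locally free and a fibre
square `X_𝔭 = X ×_A κ(𝔭)` with `Ext¹(𝒪_{X_𝔭}, G|_{X_𝔭}) = 0`, the finite free `Γ(Spec A_𝔭, 𝒪)`-module
`Γ(Spec A_𝔭, 𝒪) ⊗_{Γ(Spec A, 𝒪)} Γ(X, G)` has rank `dim_{Γ(Spec κ(𝔭), 𝒪)} Γ(X_𝔭, G|_{X_𝔭})` (flat base change ★
`Modules.exists_tensor_secMod_top_linearEquiv_of_flat` to `X ×_A A_𝔭`, whose closed fibre is `X_𝔭`, and §1).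
[cite: MumfordAV1970, §5 Cor. 2 (p. 50)] [cite: Hartshorne1977, III Thm. 12.11 (p. 290), Cor. 12.9] [cite: StacksProject, Tag 02KH] -/
theorem finrank_tensor_secMod_top_atPrime {A : Type} [CommRing A] [IsNoetherianRing A] {X : Scheme.{0}}
    (f : X ⟶ Spec (CommRingCat.of A)) [IsProper f] [Flat f] (G : X.Modules) (hL : IsFiniteLocallyFree G)
    (𝔭 : Ideal A) [𝔭.IsPrime] {X₀ : Scheme.{0}} {iX : X₀ ⟶ X} {f₀ : X₀ ⟶ Spec (CommRingCat.of 𝔭.ResidueField)}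
    (HX : IsPullback iX f₀ f (Spec.map (CommRingCat.ofHom (algebraMap A 𝔭.ResidueField))))
    (hvan : Subsingleton (Ext.{1} (unitModule X₀) ((Scheme.Modules.pullback iX).obj G) 1)) :
    letI := ((Spec.map (CommRingCat.ofHom (algebraMap A (Localization.AtPrime 𝔭)))).appLE ⊤ ⊤ le_top).hom.toAlgebra
    Module.finrank Γ(Spec (CommRingCat.of (Localization.AtPrime 𝔭)), ⊤)
        (Γ(Spec (CommRingCat.of (Localization.AtPrime 𝔭)), ⊤) ⊗[Γ(Spec (CommRingCat.of A), ⊤)]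
          SecMod G f.appTop.hom ⊤) =
      Module.finrank Γ(Spec (CommRingCat.of 𝔭.ResidueField), ⊤)
        (SecMod ((Scheme.Modules.pullback iX).obj G) f₀.appTop.hom ⊤) := by
  -- the local base `Spec A_𝔭` and its closed point `Spec κ(𝔭)`
  let Ap : Type := Localization.AtPrime 𝔭
  let jl : Spec (CommRingCat.of Ap) ⟶ Spec (CommRingCat.of A) := Spec.map (CommRingCat.ofHom (algebraMap A Ap))
  letI algL : Algebra Γ(Spec (CommRingCat.of A), ⊤) Γ(Spec (CommRingCat.of Ap), ⊤) := (jl.appLE ⊤ ⊤ le_top).hom.toAlgebra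
  change Module.finrank Γ(Spec (CommRingCat.of Ap), ⊤)
      (Γ(Spec (CommRingCat.of Ap), ⊤) ⊗[Γ(Spec (CommRingCat.of A), ⊤)] SecMod G f.appTop.hom ⊤) = _
  let j₀ : Spec (CommRingCat.of 𝔭.ResidueField) ⟶ Spec (CommRingCat.of Ap) :=
    Spec.map (CommRingCat.ofHom (IsLocalRing.residue Ap))
  have hbot : j₀ ≫ jl = Spec.map (CommRingCat.ofHom (algebraMap A 𝔭.ResidueField)) := by
    change Spec.map _ ≫ Spec.map _ = _
    rw [← Spec.map_comp, ← CommRingCat.ofHom_comp]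
    rfl
  -- `X ×_A A_𝔭`, proper and flat over the local base
  let kl : pullback f jl ⟶ X := pullback.fst f jl
  let gl : pullback f jl ⟶ Spec (CommRingCat.of Ap) := pullback.snd f jl
  have Hl : IsPullback kl gl f jl := IsPullback.of_hasPullback f jl
  haveI : IsProper gl := MorphismProperty.pullback_snd (P := @IsProper) f jl inferInstance
  haveI : Flat gl := MorphismProperty.pullback_snd (P := @Flat) f jl inferInstance
  haveI : IsLocalRing Γ(Spec (CommRingCat.of Ap), ⊤) := isLocalRing_Γ_Spec Ap
  -- the fibre square sits over the closed point of the local base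
  have HX' : IsPullback iX f₀ f (j₀ ≫ jl) := by rw [hbot]; exact HX
  let k₀ : X₀ ⟶ pullback f jl := pullback.lift iX (f₀ ≫ j₀) (by rw [Category.assoc, hbot]; exact HX.w)
  have hk₀ : k₀ ≫ kl = iX := pullback.lift_fst _ _ _
  have hk₀' : k₀ ≫ gl = f₀ ≫ j₀ := pullback.lift_snd _ _ _
  have H₀ : IsPullback k₀ f₀ gl j₀ := IsPullback.of_right (by rw [hk₀]; exact HX') hk₀' Hl
  -- the vector bundle on `X ×_A A_𝔭`, the residue-field identification, the transported vanishing
  let Gl : (pullback f jl).Modules := (Scheme.Modules.pullback kl).obj G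
  have hLl : IsFiniteLocallyFree Gl := hL.pullback kl
  obtain ⟨e₀⟩ := exists_residueField_linearEquiv_Γ_Spec Ap
  let Φ₀ : (Scheme.Modules.pullback iX).obj G ≅ (Scheme.Modules.pullback k₀).obj Gl :=
    (Scheme.Modules.pullbackCongr hk₀.symm).app G ≪≫ ((Scheme.Modules.pullbackComp k₀ kl).app G).symm
  have hvan' : Subsingleton (Ext.{1} (unitModule X₀) ((Scheme.Modules.pullback k₀).obj Gl) 1) := by
    refine ⟨fun x y => ?_⟩
    have key : ∀ z : Ext.{1} (unitModule X₀) ((Scheme.Modules.pullback k₀).obj Gl) 1,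
        z = (z.comp (Ext.mk₀ Φ₀.inv) (add_zero 1)).comp (Ext.mk₀ Φ₀.hom) (add_zero 1) := fun z => by
      rw [Ext.comp_assoc_of_second_deg_zero, Ext.mk₀_comp_mk₀, Iso.inv_hom_id, Ext.comp_mk₀_id]
    rw [key x, key y, Subsingleton.elim (x.comp _ _) (y.comp (Ext.mk₀ Φ₀.inv) (add_zero 1))]
  -- (1) over the local base: `rk Γ(X ×_A A_𝔭, G) = dim Γ(X₀, k₀^* kl^* G)` (§1)
  have h1 := finrank_secMod_top_eq_of_subsingleton_ext gl Gl hLl H₀ e₀ hvan'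
  -- (2) flat base change along `Spec A_𝔭 → Spec A`
  obtain ⟨ι, _, _, U, hcov, hUa⟩ := exists_finite_affine_cover_cechOpen f
  haveI := hL.isVectorBundle.1
  have hG : IsAffineLocalizing G := IsAffineLocalizing.of_isQuasicoherent G
  haveI : Flat jl := by
    change Flat (Spec.map (CommRingCat.ofHom (algebraMap A Ap)))
    rw [HasRingHomProperty.Spec_iff (P := @Flat)]
    change (algebraMap A Ap).Flat
    rw [RingHom.flat_algebraMap_iff]
    exact IsLocalization.flat Ap 𝔭.primeCompl
  have hflat : (jl.appLE ⊤ ⊤ le_top).hom.Flat :=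
    HasRingHomProperty.appLE (P := @Flat) jl inferInstance ⟨⊤, isAffineOpen_top _⟩ ⟨⊤, isAffineOpen_top _⟩ le_top
  obtain ⟨E₁, -⟩ := exists_tensor_secMod_top_linearEquiv_of_flat Hl U hcov hUa G hG hflat
  -- (3) `Γ(X₀, k₀^* kl^* G) ≃ Γ(X₀, iX^* G)` along `Φ₀`
  obtain ⟨L₀, -⟩ := exists_secMod_linearEquiv_of_iso f₀.appTop.hom Φ₀
  rw [E₁.finrank_eq, h1, ← L₀.finrank_eq]

end AtPrime

/-! ## §3 Over `Spec A`: the rank of `Γ(X, G)` at every prime is `h⁰` of the fibre -/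

section Global

/-- **`rk_P Γ(X, G) = r` AT EVERY PRIME, from `H¹ = 0` and `h⁰ = r` on the fibre at every prime** (Mumford §5 Cor. 2–3 /
Hartshorne III 12.11, Cor. 12.9, in degree `0`): `f : X → Spec A` proper flat, `A` noetherian, `G` finite locally free, fibre
squares `X_𝔭 = X ×_A κ(𝔭)` (any, `HX`) with `Ext¹(𝒪_{X_𝔭}, G|_{X_𝔭}) = 0` and `dim Γ(X_𝔭, G|_{X_𝔭}) = r` for every prime `𝔭`.
Then `Module.rankAtStalk Γ(X, G) ≡ r` on `Spec Γ(Spec A, 𝒪)` (Mathlib `rankAtStalk_eq_finrank_tensorProduct`; the local ring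
`Γ(Spec A, 𝒪)_P ≅ Γ(Spec A_𝔭, 𝒪)`, ★ `isLocalization_atPrime_Γ_Spec`; §2).
[cite: MumfordAV1970, §5 Cor. 2 (p. 50)] [cite: Hartshorne1977, III Thm. 12.11 (p. 290), Cor. 12.9] -/
theorem rankAtStalk_secMod_top_eq_of_forall_prime {A : Type} [CommRing A] [IsNoetherianRing A] {X : Scheme.{0}}
    (f : X ⟶ Spec (CommRingCat.of A)) [IsProper f] [Flat f] (G : X.Modules) (hL : IsFiniteLocallyFree G)
    {X₀ : ∀ (𝔭 : Ideal A) [𝔭.IsPrime], Scheme.{0}} (iX : ∀ (𝔭 : Ideal A) [𝔭.IsPrime], X₀ 𝔭 ⟶ X)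
    (f₀ : ∀ (𝔭 : Ideal A) [𝔭.IsPrime], X₀ 𝔭 ⟶ Spec (CommRingCat.of 𝔭.ResidueField))
    (HX : ∀ (𝔭 : Ideal A) [𝔭.IsPrime],
      IsPullback (iX 𝔭) (f₀ 𝔭) f (Spec.map (CommRingCat.ofHom (algebraMap A 𝔭.ResidueField))))
    (hvan : ∀ (𝔭 : Ideal A) [𝔭.IsPrime],
      Subsingleton (Ext.{1} (unitModule (X₀ 𝔭)) ((Scheme.Modules.pullback (iX 𝔭)).obj G) 1))
    (r : ℕ) (hrank : ∀ (𝔭 : Ideal A) [𝔭.IsPrime],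
      Module.finrank Γ(Spec (CommRingCat.of 𝔭.ResidueField), ⊤)
        (SecMod ((Scheme.Modules.pullback (iX 𝔭)).obj G) (f₀ 𝔭).appTop.hom ⊤) = r)
    (P : PrimeSpectrum Γ(Spec (CommRingCat.of A), ⊤)) :
    Module.rankAtStalk (SecMod G f.appTop.hom ⊤) P = r := by
  obtain ⟨hfin, hproj⟩ := finite_and_projective_secMod_top_of_forall_prime f G hL iX f₀ HX hvan
  haveI := hfin
  haveI := hproj
  let R : Type := Γ(Spec (CommRingCat.of A), ⊤)
  let φ₀ : A →+* R := (Scheme.ΓSpecIso (CommRingCat.of A)).symm.commRingCatIsoToRingEquiv.toRingHom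
  let 𝔭 : Ideal A := P.asIdeal.comap φ₀
  letI algRl : Algebra R Γ(Spec (CommRingCat.of (Localization.AtPrime 𝔭)), ⊤) :=
    ((Spec.map (CommRingCat.ofHom (algebraMap A (Localization.AtPrime 𝔭)))).appLE ⊤ ⊤ le_top).hom.toAlgebra
  haveI : IsLocalization.AtPrime Γ(Spec (CommRingCat.of (Localization.AtPrime 𝔭)), ⊤) P.asIdeal :=
    isLocalization_atPrime_Γ_Spec P.asIdeal
  let e : Localization.AtPrime P.asIdeal ≃ₐ[R] Γ(Spec (CommRingCat.of (Localization.AtPrime 𝔭)), ⊤) :=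
    IsLocalization.algEquiv P.asIdeal.primeCompl _ _
  change Module.rankAtStalk (R := R) (SecMod G f.appTop.hom ⊤) P = r
  rw [Module.rankAtStalk_eq_finrank_tensorProduct, finrank_baseChange_eq_of_algEquiv e]
  exact (finrank_tensor_secMod_top_atPrime f G hL 𝔭 (HX _) (hvan _)).trans (hrank _)

/-- **The same with Mathlib's canonical fibres** `f.fiber y` (★ `isPullback_fiberι_SpecMap_algebraMap`): `Ext¹ = 0` and
`h⁰ = r` on `f.fiber y` for every point `y` of `Spec A` ⇒ `Module.rankAtStalk Γ(X, G) ≡ r`.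
[cite: MumfordAV1970, §5 Cor. 2 (p. 50)] [cite: Hartshorne1977, III Thm. 12.11 (p. 290), Cor. 12.9] -/
theorem rankAtStalk_secMod_top_eq_of_forall_fiber {A : Type} [CommRing A] [IsNoetherianRing A] {X : Scheme.{0}}
    (f : X ⟶ Spec (CommRingCat.of A)) [IsProper f] [Flat f] (G : X.Modules) (hL : IsFiniteLocallyFree G)
    (hvan : ∀ y : Spec (CommRingCat.of A),
      Subsingleton (Ext.{1} (unitModule (f.fiber y)) ((Scheme.Modules.pullback (f.fiberι y)).obj G) 1))
    (r : ℕ) (hrank : ∀ y : Spec (CommRingCat.of A),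
      Module.finrank Γ(Spec (CommRingCat.of y.asIdeal.ResidueField), ⊤)
        (SecMod ((Scheme.Modules.pullback (f.fiberι y)).obj G)
          (f.fiberToSpecResidueField y ≫ Spec.map (Scheme.Spec.residueFieldIso (CommRingCat.of A) y).inv).appTop.hom ⊤) = r)
    (P : PrimeSpectrum Γ(Spec (CommRingCat.of A), ⊤)) :
    Module.rankAtStalk (SecMod G f.appTop.hom ⊤) P = r :=
  rankAtStalk_secMod_top_eq_of_forall_prime f G hL
    (fun (𝔭 : Ideal A) _ => f.fiberι (⟨𝔭, inferInstance⟩ : PrimeSpectrum A))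
    (fun (𝔭 : Ideal A) _ => f.fiberToSpecResidueField (⟨𝔭, inferInstance⟩ : PrimeSpectrum A) ≫
      Spec.map (Scheme.Spec.residueFieldIso (CommRingCat.of A) ⟨𝔭, inferInstance⟩).inv)
    (fun (𝔭 : Ideal A) _ => isPullback_fiberι_SpecMap_algebraMap f ⟨𝔭, inferInstance⟩)
    (fun (𝔭 : Ideal A) _ => hvan ⟨𝔭, inferInstance⟩) r (fun (𝔭 : Ideal A) _ => hrank ⟨𝔭, inferInstance⟩) P

end Global

end Literature.AlgebraicGeometry.Morphisms

end
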